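import Summits.ValiantsHypothesis.ValiantsHypothesis.Theorems.BarrierLeverAnchoredDoorHitsLowerPairsCoreSplitSpec

/-!
# Support item `AnchoredDoorHitsLowerPairs` (stmt-ValiantsHypothesis-22510), line `anchored_peeling`:
# CORE SPLITTING, part 2 — symbolic non-vanishing of 𝔄_s is inherited from the OFF-CORE FIBRES over a diagonal core

Helper file (`--supports stmt-ValiantsHypothesis-22510`; cell valiant-natproofs, rung V4; prover seat val-np-p1 gen 30; memo
HOME/val-np-p1/g30/MEMO-char2-valnp1-g30.md §8). Bookkeeping `def`s `coreCls`, `offBlock`; part 1 = `…CoreSplitSpec` (the specialisation `κ`,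
`map_coreHom_symbolicWitness : κ(W) = Δ · K(W)`). Closes NO item.

THE DEVICE (`symbolicDet_ne_zero_of_coreSplit`). Fix a set `V` of `x`-vertices (the CORE) and an injective `τ : Fin h → Fin h` (its copy on the
`y`-side). Let `(u, w)` be any layout (`r` rows and columns) and `σ` a bijection of the indices MATCHING CORE PARTS: `w (σ i) ∩ τ(V) = τ(u i ∩ V)`.
Group the rows by their core part `u i ∩ V`; inside each group read the OFF-CORE layout `coeff (x^{u i ∖ V} y^{w (σ j) ∖ τV}) (symbolicWitness s h)`
(`offBlock`). If every such square block has nonzero determinant — each is, after re-enumeration, the symbolic minor of the off-core fibre pair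
(`offBlock_det_eq_symbolicDet`), so ANY certificate of the line applies to it — then `symbolicDet s h r u w ≠ 0` (`s ≥ 1`; no injectivity or
lower-set hypothesis on `u`, `w`). Special cases: joins with a cube (`…BlockProduct`: constant fibres), the permuted diagonal (all fibres `{∅}`, no
distinct-anchor condition), and «cube + junk against cube + junk′» layouts whose junk fibres match core part by core part (deep × deep pairs outside
the Hall regime of `…DistinctAnchors`).

PROOF. By part 1 the core specialisation gives `κ(W) = Δ · K(W)`, `Δ = ∏_{a∈V}(1 + x_a y_{τa})` on the core variables, `K(W)` off them
(`ThinStep.coeff_killVars`); the separated product rule (`coeff_mul_of_separated`) and `coeff_coreDelta` give the specialised layout entry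
`[w j ∩ τV = τ(u i ∩ V)] · coeff (x^{u i∖V} y^{w j∖τV}) W` (`coeff_map_coreHom_symbolicWitness`); after the column permutation `σ` the matrix is block
diagonal by core class (`Matrix.BlockTriangular.det`), so `κ(symbolicDet) = ± ∏ (fibre determinants) ≠ 0`.

WHAT THIS IS NOT: a closure / transfer device; nothing on which fibre pairs are hit, on crux stmt-ValiantsHypothesis-14610, or on `VP ≠ VNP`.
-/

set_option linter.dupNamespace false

namespace Summit.ValiantsHypothesis.ValiantsHypothesis.Theorems.BarrierLever.AnchoredPeeling

open Finset MvPolynomial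
open Summit.ValiantsHypothesis.ValiantsHypothesis.Theorems.BarrierLever.BrickCalculus (pexpo pexpo_def pexpo_le_iff pexpo_sub
  pexpo_apply_castAdd pexpo_apply_natAdd)

noncomputable section

namespace CoreSplit

variable {h : ℕ}

/-! ## 4. Layout coefficients: core and off-core variables separate -/

/-- Every variable of `Fin (h + h)` is an `x`- or a `y`-variable. -/
theorem eq_castAdd_or_natAdd (v : Fin (h + h)) : (∃ a, v = Fin.castAdd h a) ∨ (∃ c, v = Fin.natAdd h c) := by
  rcases hv : finSumFinEquiv.symm v with a | c
  · left; refine ⟨a, ?_⟩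
    have := congrArg finSumFinEquiv hv
    rw [Equiv.apply_symm_apply] at this
    rw [this]; rfl
  · right; refine ⟨c, ?_⟩
    have := congrArg finSumFinEquiv hv
    rw [Equiv.apply_symm_apply] at this
    rw [this]; rfl

/-- The support of `x^U y^W` consists of the `x_a`, `a ∈ U`, and the `y_c`, `c ∈ W`. -/
theorem mem_support_pexpo {U W : Finset (Fin h)} {v : Fin (h + h)} (hv : v ∈ (pexpo U W).support) :
    (∃ a ∈ U, v = Fin.castAdd h a) ∨ (∃ c ∈ W, v = Fin.natAdd h c) := by
  rw [Finsupp.mem_support_iff] at hv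
  rcases eq_castAdd_or_natAdd v with ⟨a, rfl⟩ | ⟨c, rfl⟩
  · left; refine ⟨a, ?_, rfl⟩
    rw [pexpo_apply_castAdd] at hv
    by_contra ha; exact hv (if_neg ha)
  · right; refine ⟨c, ?_, rfl⟩
    rw [pexpo_apply_natAdd] at hv
    by_contra hc; exact hv (if_neg hc)

/-- Core sets give core monomials. -/
theorem support_pexpo_subset_coreVars {V : Finset (Fin h)} {τ : Fin h → Fin h} {C C' : Finset (Fin h)} (hC : C ⊆ V)
    (hC' : C' ⊆ V.image τ) : (pexpo C C').support ⊆ coreVars V τ := by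
  intro v hv
  rcases mem_support_pexpo hv with ⟨a, ha, rfl⟩ | ⟨c, hc, rfl⟩
  · exact castAdd_mem_coreVars.mpr (hC ha)
  · exact natAdd_mem_coreVars.mpr (hC' hc)

/-- Off-core sets give monomials avoiding the core variables. -/
theorem disjoint_support_pexpo_coreVars {V : Finset (Fin h)} {τ : Fin h → Fin h} {D D' : Finset (Fin h)}
    (hD : D ∩ V = ∅) (hD' : D' ∩ V.image τ = ∅) : Disjoint (pexpo D D').support (coreVars V τ) := by
  rw [Finset.disjoint_left]
  intro v hv hcore
  rcases mem_support_pexpo hv with ⟨a, ha, rfl⟩ | ⟨c, hc, rfl⟩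
  · have : a ∈ D ∩ V := Finset.mem_inter.mpr ⟨ha, castAdd_mem_coreVars.mp hcore⟩
    rw [hD] at this; exact Finset.notMem_empty a this
  · have : c ∈ D' ∩ V.image τ := Finset.mem_inter.mpr ⟨hc, natAdd_mem_coreVars.mp hcore⟩
    rw [hD'] at this; exact Finset.notMem_empty c this

/-- `Δ` as a sum of monomials: `Σ_{D ⊆ V} x^D y^{τ D}` (`τ` injective). -/
theorem coreDelta_eq_sum (V : Finset (Fin h)) {τ : Fin h → Fin h} (hτ : Function.Injective τ) :
    coreDelta V τ = ∑ D ∈ V.powerset, monomial (pexpo D (D.image τ)) (1 : MvPolynomial (Param h) ℂ) := by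
  classical
  rw [coreDelta, Finset.prod_one_add]
  refine Finset.sum_congr rfl fun D _ => ?_
  rw [Finset.prod_mul_distrib, prod_X_eq_monomial', ← Finset.prod_image (s := D) (g := τ)
      (f := fun c => (X (Fin.natAdd h c) : MvPolynomial (Fin (h + h)) (MvPolynomial (Param h) ℂ)))
      (fun a _ b _ hab => hτ hab),
    prod_X_eq_monomial', monomial_mul, mul_one, ← pexpo_def]

/-- **Layout of `Δ`:** `[x^C y^{C'}] Δ = [C ⊆ V ∧ C' = τ(C)]`. -/
theorem coeff_coreDelta (V : Finset (Fin h)) {τ : Fin h → Fin h} (hτ : Function.Injective τ) (C C' : Finset (Fin h)) :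
    coeff (pexpo C C') (coreDelta V τ) = if C ⊆ V ∧ C' = C.image τ then 1 else 0 := by
  classical
  rw [coreDelta_eq_sum V hτ, coeff_sum]
  simp_rw [coeff_monomial]
  have hterm : ∀ D ∈ V.powerset, (if pexpo D (D.image τ) = pexpo C C' then (1 : MvPolynomial (Param h) ℂ) else 0) =
      if D = C then (if C' = C.image τ then 1 else 0) else 0 := by
    intro D _
    by_cases hDC : D = C
    · subst hDC
      by_cases hC' : C' = D.image τ
      · rw [if_pos (by rw [hC']), if_pos rfl, if_pos hC']
      · rw [if_neg (fun heq => hC' (DistinctAnchors.pexpo_inj heq).2.symm), if_pos rfl, if_neg hC']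
    · rw [if_neg (fun heq => hDC (DistinctAnchors.pexpo_inj heq).1), if_neg hDC]
  rw [Finset.sum_congr rfl hterm, Finset.sum_ite_eq' V.powerset C]
  by_cases hCV : C ⊆ V
  · rw [if_pos (Finset.mem_powerset.mpr hCV)]
    by_cases hC' : C' = C.image τ
    · rw [if_pos hC', if_pos ⟨hCV, hC'⟩]
    · rw [if_neg hC', if_neg (fun hh => hC' hh.2)]
  · rw [if_neg (fun hm => hCV (Finset.mem_powerset.mp hm)), if_neg (fun hh => hCV hh.1)]

/-- The monomials of `Δ` live on the core variables. -/
theorem support_subset_of_coeff_coreDelta (V : Finset (Fin h)) {τ : Fin h → Fin h} (hτ : Function.Injective τ)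
    {m : Fin (h + h) →₀ ℕ} (hm : coeff m (coreDelta V τ) ≠ 0) : m.support ⊆ coreVars V τ := by
  classical
  rw [coreDelta_eq_sum V hτ, coeff_sum] at hm
  obtain ⟨D, hD, hne⟩ := Finset.exists_ne_zero_of_sum_ne_zero hm
  rw [coeff_monomial] at hne
  by_cases heq : pexpo D (D.image τ) = m
  · rw [← heq]
    exact support_pexpo_subset_coreVars (Finset.mem_powerset.mp hD) (Finset.image_subset_image (Finset.mem_powerset.mp hD))
  · exact absurd (if_neg heq) hne

section Separated

variable {σ : Type*} {R : Type*} [CommSemiring R] [DecidableEq σ]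

/-- **Separated product rule for coefficients.** If every monomial of `f` lives on `S` and every monomial of `g` off `S`, then
`[m₁ + m₂] (f g) = [m₁] f · [m₂] g` for `m₁` on `S` and `m₂` off `S`. -/
theorem coeff_mul_of_separated (S : Finset σ) (f g : MvPolynomial σ R)
    (hf : ∀ m, coeff m f ≠ 0 → m.support ⊆ S) (hg : ∀ m, coeff m g ≠ 0 → Disjoint m.support S)
    {m₁ m₂ : σ →₀ ℕ} (h₁ : m₁.support ⊆ S) (h₂ : Disjoint m₂.support S) :
    coeff (m₁ + m₂) (f * g) = coeff m₁ f * coeff m₂ g := by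
  classical
  have hkey : ∀ p ∈ Finset.HasAntidiagonal.antidiagonal (m₁ + m₂), p ≠ (m₁, m₂) → coeff p.1 f * coeff p.2 g = 0 := by
    rintro ⟨a, b⟩ hab hne
    have hab' : a + b = m₁ + m₂ := by
      rw [Finset.HasAntidiagonal.mem_antidiagonal] at hab
      exact hab
    by_contra hprod
    have ha : coeff a f ≠ 0 := fun h0 => hprod (by rw [h0, zero_mul])
    have hb : coeff b g ≠ 0 := fun h0 => hprod (by rw [h0, mul_zero])
    have haS := hf a ha
    have hbS := hg b hb
    have haeq : a = m₁ := by
      ext i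
      have hi : a i + b i = m₁ i + m₂ i := by
        have := congrArg (fun m : σ →₀ ℕ => m i) hab'
        simpa only [Finsupp.add_apply] using this
      by_cases hiS : i ∈ S
      · have hb0 : b i = 0 := Finsupp.notMem_support_iff.mp (fun hib => Finset.disjoint_left.mp hbS hib hiS)
        have hm0 : m₂ i = 0 := Finsupp.notMem_support_iff.mp (fun him => Finset.disjoint_left.mp h₂ him hiS)
        rw [hb0, hm0, add_zero, add_zero] at hi
        exact hi
      · have ha0 : a i = 0 := Finsupp.notMem_support_iff.mp (fun hia => hiS (haS hia))
        have hm0 : m₁ i = 0 := Finsupp.notMem_support_iff.mp (fun him => hiS (h₁ him))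
        rw [ha0, hm0]
    have hbeq : b = m₂ := by
      rw [haeq] at hab'
      exact add_left_cancel hab'
    exact hne (Prod.ext haeq hbeq)
  have hmem : (m₁, m₂) ∈ Finset.HasAntidiagonal.antidiagonal (m₁ + m₂) := by
    rw [Finset.HasAntidiagonal.mem_antidiagonal]
  rw [coeff_mul, Finset.sum_eq_single (m₁, m₂) hkey (fun hnot => absurd hmem hnot)]

end Separated

/-- **The specialised layout entry:** `[x^U y^W] κ(W_s) = [W ∩ τV = τ(U ∩ V)] · [x^{U∖V} y^{W∖τV}] W_s`. -/
theorem coeff_map_coreHom_symbolicWitness {s : ℕ} (hs : 1 ≤ s) (V : Finset (Fin h)) {τ : Fin h → Fin h}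
    (hτ : Function.Injective τ) (U W : Finset (Fin h)) :
    coeff (pexpo U W) (MvPolynomial.map (coreHom V τ) (symbolicWitness s h)) =
      (if W ∩ V.image τ = (U ∩ V).image τ then 1 else 0) *
        coeff (pexpo (U \ V) (W \ V.image τ)) (symbolicWitness s h) := by
  classical
  have hdisjU : Disjoint (U ∩ V) (U \ V) :=
    Finset.disjoint_left.mpr fun a ha ha' => (Finset.mem_sdiff.mp ha').2 (Finset.mem_inter.mp ha).2
  have hdisjW : Disjoint (W ∩ V.image τ) (W \ V.image τ) :=
    Finset.disjoint_left.mpr fun c hc hc' => (Finset.mem_sdiff.mp hc').2 (Finset.mem_inter.mp hc).2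
  have hsplit : pexpo U W = pexpo (U ∩ V) (W ∩ V.image τ) + pexpo (U \ V) (W \ V.image τ) := by
    rw [← pexpo_union hdisjU hdisjW, Finset.union_comm (U ∩ V), Finset.sdiff_union_inter,
      Finset.union_comm (W ∩ V.image τ), Finset.sdiff_union_inter]
  have hUV : (U \ V) ∩ V = ∅ := by
    ext a; simp
  have hWV : (W \ V.image τ) ∩ V.image τ = ∅ := by
    ext c; simp
  rw [hsplit, map_coreHom_symbolicWitness hs V τ,
    coeff_mul_of_separated (coreVars V τ) _ _ (fun m hm => support_subset_of_coeff_coreDelta V hτ hm)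
      (fun m hm => by
        by_contra hnd
        exact hm (ThinStep.coeff_killVars_of_not_disjoint _ _ hnd))
      (support_pexpo_subset_coreVars Finset.inter_subset_right Finset.inter_subset_right)
      (disjoint_support_pexpo_coreVars hUV hWV),
    coeff_coreDelta V hτ, ThinStep.coeff_killVars_of_disjoint _ _ (disjoint_support_pexpo_coreVars hUV hWV)]
  congr 1
  by_cases hc : W ∩ V.image τ = (U ∩ V).image τ
  · rw [if_pos ⟨Finset.inter_subset_right, hc⟩, if_pos hc]
  · rw [if_neg (fun hh => hc hh.2), if_neg hc]

/-! ## 5. The determinant: block diagonal by core class -/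

/-- The core class of row `i`: a code of its core part `u i ∩ V`. -/
def coreCls (V : Finset (Fin h)) {r : ℕ} (u : Fin r → Finset (Fin h)) (i : Fin r) : ℕ :=
  Encodable.encode (u i ∩ V)

/-- Core classes determine core parts. -/
theorem coreCls_eq_iff (V : Finset (Fin h)) {r : ℕ} (u : Fin r → Finset (Fin h)) (i j : Fin r) :
    coreCls V u i = coreCls V u j ↔ u i ∩ V = u j ∩ V :=
  Encodable.encode_injective.eq_iff

/-- **The off-core block of the core class `c`:** rows `i` and columns `σ j` of class `c`, entries the off-core layout coefficients
`[x^{u i ∖ V} y^{w (σ j) ∖ τV}] symbolicWitness s h`. -/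
def offBlock (s h : ℕ) (V : Finset (Fin h)) (τ : Fin h → Fin h) {r : ℕ} (u w : Fin r → Finset (Fin h)) (σ : Equiv.Perm (Fin r))
    (c : ℕ) : Matrix {i : Fin r // coreCls V u i = c} {i : Fin r // coreCls V u i = c} (MvPolynomial (Param h) ℂ) :=
  Matrix.of fun i j => coeff (pexpo (u i \ V) (w (σ j) \ V.image τ)) (symbolicWitness s h)

/-- **CORE SPLITTING.** If the columns can be matched to the rows respecting core parts (`w (σ i) ∩ τV = τ(u i ∩ V)`) and every off-core
block of a core class has nonzero determinant, then the symbolic minor of the anchored door on `(u, w)` is nonzero (`s ≥ 1`, `τ` injective). -/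
theorem symbolicDet_ne_zero_of_coreSplit {s : ℕ} (hs : 1 ≤ s) (V : Finset (Fin h)) {τ : Fin h → Fin h}
    (hτ : Function.Injective τ) {r : ℕ} (u w : Fin r → Finset (Fin h)) (σ : Equiv.Perm (Fin r))
    (hcore : ∀ i, w (σ i) ∩ V.image τ = (u i ∩ V).image τ)
    (hblk : ∀ c, (offBlock s h V τ u w σ c).det ≠ 0) : symbolicDet s h r u w ≠ 0 := by
  classical
  -- the specialised layout matrix
  set M : Matrix (Fin r) (Fin r) (MvPolynomial (Param h) ℂ) := Matrix.of fun i j =>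
    (if w j ∩ V.image τ = (u i ∩ V).image τ then 1 else 0) * coeff (pexpo (u i \ V) (w j \ V.image τ)) (symbolicWitness s h)
    with hM
  have hmap : coreHom V τ (symbolicDet s h r u w) = M.det := by
    unfold symbolicDet
    rw [RingHom.map_det]
    congr 1
    ext i j
    simp only [RingHom.mapMatrix_apply, Matrix.map_apply, Matrix.of_apply, hM]
    rw [← MvPolynomial.coeff_map, ← pexpo_def, coeff_map_coreHom_symbolicWitness hs V hτ]
  -- permute the columns by σ: block diagonal by core class
  set N : Matrix (Fin r) (Fin r) (MvPolynomial (Param h) ℂ) := M.submatrix id σ with hN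
  have hNentry : ∀ i j, N i j = (if coreCls V u j = coreCls V u i then 1 else 0) *
      coeff (pexpo (u i \ V) (w (σ j) \ V.image τ)) (symbolicWitness s h) := by
    intro i j
    simp only [hN, hM, Matrix.submatrix_apply, id_eq, Matrix.of_apply, hcore j]
    congr 1
    by_cases hij : coreCls V u j = coreCls V u i
    · rw [if_pos hij, if_pos (by rw [(coreCls_eq_iff V u j i).mp hij])]
    · rw [if_neg hij, if_neg (fun hh => hij ((coreCls_eq_iff V u j i).mpr (Finset.image_injective hτ hh)))]
  have hBT : N.BlockTriangular (coreCls V u) := by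
    intro i j hlt
    rw [hNentry, if_neg (Nat.ne_of_lt hlt), zero_mul]
  have hdetN : N.det = ∏ c ∈ Finset.univ.image (coreCls V u), (offBlock s h V τ u w σ c).det := by
    rw [hBT.det]
    refine Finset.prod_congr rfl fun c _ => ?_
    congr 1
    ext ⟨i, hi⟩ ⟨j, hj⟩
    rw [Matrix.toSquareBlock_def, Matrix.of_apply, hNentry, offBlock, Matrix.of_apply, if_pos (hj.trans hi.symm), one_mul]
  have hNne : N.det ≠ 0 := by
    rw [hdetN]
    exact Finset.prod_ne_zero_iff.mpr fun c _ => hblk c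
  have hMne : M.det ≠ 0 := by
    intro h0
    apply hNne
    rw [hN, Matrix.det_permute', h0, mul_zero]
  intro h0
  apply hMne
  rw [← hmap, h0, map_zero]

/-- **Reading an off-core block as a symbolic minor.** After enumerating the core class `c` by `e`, the block determinant is the symbolic
minor of the off-core fibre pair `(u · ∖ V, w (σ ·) ∖ τV)` — so every certificate of the line applies to it. -/
theorem offBlock_det_eq_symbolicDet (s h : ℕ) (V : Finset (Fin h)) (τ : Fin h → Fin h) {r : ℕ} (u w : Fin r → Finset (Fin h))
    (σ : Equiv.Perm (Fin r)) (c : ℕ) {r' : ℕ} (e : {i : Fin r // coreCls V u i = c} ≃ Fin r') :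
    (offBlock s h V τ u w σ c).det =
      symbolicDet s h r' (fun k => u (e.symm k) \ V) (fun k => w (σ (e.symm k)) \ V.image τ) := by
  unfold symbolicDet offBlock
  rw [← Matrix.det_reindex_self e]
  rfl


/-! ## 6. Example: the permuted diagonal, with no distinct-anchor hypothesis -/

/-- **Permuted diagonal layouts are hit at every profile `s ≥ 1`:** rows inside the core `V`, injective, and the matched columns their
`τ`-copies (`w (σ i) = τ(u i)`). Every core class is a single row with off-core fibre `(∅ | ∅)`, whose layout coefficient is `1`. -/
theorem symbolicDet_ne_zero_of_permutedDiagonal {s : ℕ} (hs : 1 ≤ s) (V : Finset (Fin h)) {τ : Fin h → Fin h}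
    (hτ : Function.Injective τ) {r : ℕ} (u w : Fin r → Finset (Fin h)) (hu : Function.Injective u) (σ : Equiv.Perm (Fin r))
    (hrows : ∀ i, u i ⊆ V) (hcols : ∀ i, w (σ i) = (u i).image τ) : symbolicDet s h r u w ≠ 0 := by
  classical
  have hcoreEq : ∀ i, u i ∩ V = u i := fun i => Finset.inter_eq_left.mpr (hrows i)
  refine symbolicDet_ne_zero_of_coreSplit hs V hτ u w σ (fun i => ?_) (fun c => ?_)
  · rw [hcols i, hcoreEq i]
    exact Finset.inter_eq_left.mpr (Finset.image_subset_image (hrows i))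
  · -- the block of class `c` is the identity matrix on at most one index
    have hsub : ∀ i j : {i : Fin r // coreCls V u i = c}, i = j := by
      rintro ⟨i, hi⟩ ⟨j, hj⟩
      have hij : u i ∩ V = u j ∩ V := (coreCls_eq_iff V u i j).mp (hi.trans hj.symm)
      rw [hcoreEq i, hcoreEq j] at hij
      exact Subtype.ext (hu hij)
    have hone : offBlock s h V τ u w σ c = 1 := by
      refine Matrix.ext fun i j => ?_
      obtain rfl := hsub i j
      rw [Matrix.one_apply_eq, offBlock, Matrix.of_apply, Finset.sdiff_eq_empty_iff_subset.mpr (hrows i), hcols i,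
        Finset.sdiff_eq_empty_iff_subset.mpr (Finset.image_subset_image (hrows i)), pexpo_def]
      simp only [Finset.sum_empty, add_zero]
      rw [← MvPolynomial.constantCoeff_eq]
      exact constantCoeff_symbolicWitness s h
    rw [hone, Matrix.det_one]
    exact one_ne_zero

end CoreSplit

end

end Summit.ValiantsHypothesis.ValiantsHypothesis.Theorems.BarrierLever.AnchoredPeeling
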